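import Summits.QuantumFields.YangMills.Theorems.LuscherReductionRunningReductionCoarseUpperGlue
import HarnessLib

/-!
# INNER NO-INTRUDER: reduction to ONE gauge-invariant family at the trivial orbit — the eight-copies step (fixed-lattice programme COARSE(L₀) —
# route `LuscherReduction`, crux RED stmt-QuantumFields-19978 KT-door 3b′ / crux `TwistedTraceScaling` stmt-QuantumFields-20203 S-BASE; design note
# `pub/ym-fleet/ym-luscher-20007-p1/COARSE-DESIGN.md` §7 brick (i), §9 remark (ii))

`InnerNoIntruderAt L δ` (I(L), `…CoarseUpperDefs`) quantifies over families of PHYSICAL (gauge- and twist-invariant) functions supported in the union of the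
eight inner neighbourhoods `{orbitDist(τ_z U) < δ}`.  The Born–Oppenheimer analysis (C4) naturally works near ONE pure-gauge orbit, with gauge-invariant
functions only.  This file states that one-orbit form and proves it suffices:
* `InnerNoIntruderOneOrbitAt L δ` — **I₁(L)**: the same min–max conclusion for families `G₀…G_k` of bounded measurable GAUGE-invariant functions
  supported in `{orbitDist U < δ(β)}` (no twist condition);
* `orbitCut δ F = 𝟙{orbitDist < δ}·F`; for a physical `F` supported in the inner union and `L·δ < 2`: `twistSum (orbitCut δ F) = F`
  (`twistSum_orbitCut`; at most one twisted orbit is `δ`-close, `twist3_eq_of_orbitDist_lt`), so `Σ aᵢFᵢ = twistSum(Σ aᵢ Gᵢ)` with `Gᵢ = orbitCut δ Fᵢ`,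
  `‖Σ aᵢFᵢ‖² = 8‖Σ aᵢGᵢ‖²` (`l2_twistSum`) and `⟨Σ aᵢFᵢ, K Σ aᵢFᵢ⟩ ≤ 8⟨Σ aᵢGᵢ, K Σ aᵢGᵢ⟩ + 56·crossBound·‖Σ aᵢGᵢ‖²` (`abs_qform_twistSum_sub_le`);
* `crossBound_eventually_small` — the cross terms `e^{2β|E|}e^{−βm²/(2|E|)}` are negligible against `λ_b · uniformFloorConst · c_β^{|E|}`
  (`c_β ≥ e^{2β}·w₀/(4β²)` from the window mass, `λ_b ≥ 2/(L³β)`, and `β^N e^{−cβ} → 0`);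
* ★ `innerNoIntruderAt_of_oneOrbit : (∀ β, 0 < δ β) → (eventually δ β ≤ 1/(2L)) → InnerNoIntruderOneOrbitAt L δ → InnerNoIntruderAt L δ`.
With `coarseNoIntruderAt_of_valley_inner`: COARSE-UPPER(L) ⇐ V(L) + I₁(L).
HONEST FRAMING: a reduction; I₁(L) (the Born–Oppenheimer comparison proper) and V(L) are OPEN; femto rung R2b1; not infinite volume, not a gap, not Clay.
-/

set_option autoImplicit false

noncomputable section

open MeasureTheory Filter Topology Real
open scoped BigOperators
open Literature.MathematicalPhysics.QuantumFieldTheory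
open Literature.MathematicalPhysics.QuantumLattice

namespace Summit.QuantumFields.YangMills.Theorems.FemtoTransferGap

variable {L : ℕ} [NeZero L]

/-! ## §1 The one-orbit target text -/

variable (L) in
/-- **I₁(L) — INNER NO-INTRUDER at ONE orbit** (sub-stub C4 of COARSE(L), upper direction, one-orbit subspace form; OPEN, XL).  For every `k`, `ε > 0`,
eventually in `β`: every family `G₀ … G_k` of bounded measurable GAUGE-invariant functions supported in `{orbitDist U < δ(β)}` (the `δ`-neighbourhood of
the orbit of the trivial connection) with nondegenerate Gram matrix has a nonzero combination `ψ = Σ aᵢGᵢ` with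
`⟨ψ,K_βψ⟩·μ₀ ≤ e^{ελ_b(L³β)}·μ_k·λ₀(β,L)·‖ψ‖²` (`μ_j` = one-site levels at `B' = L³β`).  Target text of this programme (Born–Oppenheimer projection onto the
stiff Gaussian ground state in the comb gauge; Lüscher 1983 §3), not a published theorem. -/
def InnerNoIntruderOneOrbitAt (δ : ℝ → ℝ) : Prop :=
  ∀ k : ℕ, ∀ ε : ℝ, 0 < ε → ∃ β0 : ℝ, ∀ β : ℝ, β0 ≤ β →
    ∀ G : Fin (k + 1) → (GaugeConfig 3 L SU2 → ℝ),
      (∀ i, Measurable (G i)) → (∀ i, ∃ C : ℝ, ∀ U, |G i U| ≤ C) →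
      (∀ i (g : Site 3 L → SU2) (U : GaugeConfig 3 L SU2), G i (gaugeTransform g U) = G i U) →
      (∀ i U, G i U ≠ 0 → orbitDist U < δ β) →
      (∀ a : Fin (k + 1) → ℝ, a ≠ 0 → 0 < l2 (fun U => ∑ i, a i * G i U) (fun U => ∑ i, a i * G i U)) →
        ∃ a : Fin (k + 1) → ℝ, a ≠ 0 ∧
          qform su2Rep β (fun U => ∑ i, a i * G i U) (fun U => ∑ i, a i * G i U) * levelValue su2Rep 1 ((L : ℝ) ^ 3 * β) 0 ≤
            Real.exp (ε * bareLambda ((L : ℝ) ^ 3 * β)) * levelValue su2Rep 1 ((L : ℝ) ^ 3 * β) k * levelValue su2Rep L β 0 *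
              l2 (fun U => ∑ i, a i * G i U) (fun U => ∑ i, a i * G i U)

/-! ## §2 The one-orbit cut of a physical function -/

/-- **One-orbit cut** `orbitCut δ F = 𝟙{orbitDist U < δ} · F`. [folklore] -/
def orbitCut (δ : ℝ) (F : GaugeConfig 3 L SU2 → ℝ) : GaugeConfig 3 L SU2 → ℝ := fun U => if orbitDist U < δ then F U else 0

/-- The cut is measurable. [folklore] -/
theorem measurable_orbitCut (δ : ℝ) {F : GaugeConfig 3 L SU2 → ℝ} (hF : Measurable F) : Measurable (orbitCut δ F) :=
  Measurable.ite (measurableSet_lt measurable_orbitDist measurable_const) hF measurable_const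

/-- The cut keeps the bound. [folklore] -/
theorem abs_orbitCut_le (δ : ℝ) {F : GaugeConfig 3 L SU2 → ℝ} {C : ℝ} (hC : ∀ U, |F U| ≤ C) (U : GaugeConfig 3 L SU2) : |orbitCut δ F U| ≤ C := by
  unfold orbitCut
  split_ifs
  · exact hC U
  · rw [abs_zero]; exact (abs_nonneg _).trans (hC U)

/-- The cut of a gauge-invariant function is gauge invariant. [folklore] -/
theorem orbitCut_gaugeTransform (δ : ℝ) {F : GaugeConfig 3 L SU2 → ℝ} (hF : ∀ (g : Site 3 L → SU2) U, F (gaugeTransform g U) = F U)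
    (g : Site 3 L → SU2) (U : GaugeConfig 3 L SU2) : orbitCut δ F (gaugeTransform g U) = orbitCut δ F U := by
  unfold orbitCut; rw [orbitDist_gaugeTransform, hF]

/-- The cut is supported in `{orbitDist < δ}`. [folklore] -/
theorem orbitDist_lt_of_orbitCut_ne_zero {δ : ℝ} {F : GaugeConfig 3 L SU2 → ℝ} {U : GaugeConfig 3 L SU2} (h : orbitCut δ F U ≠ 0) :
    orbitDist U < δ := by
  unfold orbitCut at h
  by_contra hlt
  rw [if_neg hlt] at h
  exact h rfl

/-- ★ **A physical function supported in the inner union is the twist symmetrisation of its one-orbit cut** (`L·δ < 2`). [folklore] -/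
theorem twistSum_orbitCut {δ : ℝ} (hLδ : (L : ℝ) * δ < 2) {F : GaugeConfig 3 L SU2 → ℝ} (hF : IsPhys F)
    (hsupp : ∀ U, F U ≠ 0 → ∃ z : Fin 3 → Bool, orbitDist (TT.twist3 z U) < δ) : twistSum (orbitCut δ F) = F := by
  funext U
  unfold twistSum orbitCut
  simp_rw [TT.twist3_eq_of_isPhys hF]
  by_cases h : ∃ z : Fin 3 → Bool, orbitDist (TT.twist3 z U) < δ
  · obtain ⟨z0, hz0⟩ := h
    rw [← Finset.add_sum_erase _ _ (Finset.mem_univ z0), if_pos hz0, Finset.sum_eq_zero (fun z hz => ?_), add_zero]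
    rw [if_neg]
    intro hz'
    exact (Finset.ne_of_mem_erase hz) (twist3_eq_of_orbitDist_lt hLδ hz' hz0)
  · push Not at h
    have hF0 : F U = 0 := by
      by_contra hne
      obtain ⟨z, hz⟩ := hsupp U hne
      exact absurd hz (not_lt.mpr (h z))
    simp only [hF0, ite_self, Finset.sum_const_zero]

/-! ## §3 Finite combinations of cuts -/

omit [NeZero L] in
/-- `twistSum` is linear over finite combinations. [folklore] -/
theorem twistSum_sum_mul {k : ℕ} (a : Fin (k + 1) → ℝ) (φ : Fin (k + 1) → GaugeConfig 3 L SU2 → ℝ) :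
    twistSum (fun U => ∑ i, a i * φ i U) = fun U => ∑ i, a i * twistSum (φ i) U := by
  funext U
  unfold twistSum
  rw [Finset.sum_comm]
  exact Finset.sum_congr rfl fun i _ => by rw [Finset.mul_sum]

/-- A finite combination of cuts is measurable. [folklore] -/
theorem measurable_sum_mul_orbitCut (δ : ℝ) {k : ℕ} (a : Fin (k + 1) → ℝ) {F : Fin (k + 1) → GaugeConfig 3 L SU2 → ℝ}
    (hF : ∀ i, Measurable (F i)) : Measurable fun U => ∑ i, a i * orbitCut δ (F i) U :=
  Finset.measurable_sum _ fun i _ => (measurable_orbitCut δ (hF i)).const_mul _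

/-- … bounded by `Σ |aᵢ| Cᵢ`. [folklore] -/
theorem abs_sum_mul_orbitCut_le (δ : ℝ) {k : ℕ} (a : Fin (k + 1) → ℝ) {F : Fin (k + 1) → GaugeConfig 3 L SU2 → ℝ} {C : Fin (k + 1) → ℝ}
    (hC : ∀ i U, |F i U| ≤ C i) (U : GaugeConfig 3 L SU2) : |∑ i, a i * orbitCut δ (F i) U| ≤ ∑ i, |a i| * C i := by
  refine (Finset.abs_sum_le_sum_abs _ _).trans (Finset.sum_le_sum fun i _ => ?_)
  rw [abs_mul]
  exact mul_le_mul_of_nonneg_left (abs_orbitCut_le δ (hC i) U) (abs_nonneg _)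

/-- … gauge invariant. [folklore] -/
theorem sum_mul_orbitCut_gaugeTransform (δ : ℝ) {k : ℕ} (a : Fin (k + 1) → ℝ) {F : Fin (k + 1) → GaugeConfig 3 L SU2 → ℝ}
    (hF : ∀ i (g : Site 3 L → SU2) U, F i (gaugeTransform g U) = F i U) (g : Site 3 L → SU2) (U : GaugeConfig 3 L SU2) :
    ∑ i, a i * orbitCut δ (F i) (gaugeTransform g U) = ∑ i, a i * orbitCut δ (F i) U :=
  Finset.sum_congr rfl fun i _ => by rw [orbitCut_gaugeTransform δ (hF i)]

/-- … supported in `{orbitDist < δ}`. [folklore] -/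
theorem orbitDist_lt_of_sum_mul_orbitCut_ne_zero {δ : ℝ} {k : ℕ} (a : Fin (k + 1) → ℝ) (F : Fin (k + 1) → GaugeConfig 3 L SU2 → ℝ)
    {U : GaugeConfig 3 L SU2} (h : ∑ i, a i * orbitCut δ (F i) U ≠ 0) : orbitDist U < δ := by
  by_contra hlt
  apply h
  exact Finset.sum_eq_zero fun i _ => by unfold orbitCut; rw [if_neg hlt, mul_zero]

/-! ## §4 The cross terms are negligible against the floor -/

/-- **`c_β ≥ e^{2β}·w₀/(4β²)`** with `w₀ = e^{−1/2}·8/(3π³)` for `β ≥ 1` (window mass at radius `1/√β` + the `t^{3/2}` law, `x√x ≥ x²` for `x ≤ 1`). [folklore] -/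
theorem linkC_ge_poly {β : ℝ} (hβ : 1 ≤ β) :
    Real.exp (2 * β) * (Real.exp (-(1 / 2 : ℝ)) * (8 / (3 * π ^ 3)) / (4 * β ^ 2)) ≤ linkC β := by
  have hβ0 : 0 < β := by linarith
  have hsβ : 0 < Real.sqrt β := Real.sqrt_pos.2 hβ0
  have hsβ1 : 1 ≤ Real.sqrt β := by rw [← Real.sqrt_one]; exact Real.sqrt_le_sqrt hβ
  have h1 := windowMass_le_linkC hβ0.le (1 / Real.sqrt β)
  have h2 := windowMass_ge hβ0.le (1 / Real.sqrt β)
  have hr2 : (1 / Real.sqrt β) ^ 2 = 1 / β := by rw [div_pow, one_pow, Real.sq_sqrt hβ0.le]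
  have hexp : Real.exp (-(β * (1 / Real.sqrt β) ^ 2 / 2)) = Real.exp (-(1 / 2 : ℝ)) := by
    rw [hr2]; congr 1; field_simp
  have h3 := ballVol_ge_threeHalves (r := 1 / Real.sqrt β) (by positivity) (by rw [div_le_iff₀ hsβ]; linarith)
  rw [hr2] at h3
  -- `x√x ≥ x²` at `x = 1/(2β) ≤ 1`
  have hx1 : 1 / β / 2 ≤ 1 := by rw [div_div, div_le_one (by positivity)]; linarith
  have hx0 : 0 ≤ 1 / β / 2 := by positivity
  have hsq : 1 / β / 2 ≤ Real.sqrt (1 / β / 2) := by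
    rw [Real.le_sqrt hx0 hx0]; nlinarith
  have h4 : 1 / (4 * β ^ 2) ≤ 1 / β / 2 * Real.sqrt (1 / β / 2) := by
    have e : 1 / (4 * β ^ 2) = (1 / β / 2) * (1 / β / 2) := by field_simp; ring
    rw [e]; exact mul_le_mul_of_nonneg_left hsq hx0
  have h5 : Real.exp (-(1 / 2 : ℝ)) * (8 / (3 * π ^ 3)) / (4 * β ^ 2) ≤ Real.exp (-(1 / 2 : ℝ)) * ballVol (1 / Real.sqrt β) := by
    have : Real.exp (-(1 / 2 : ℝ)) * (8 / (3 * π ^ 3)) / (4 * β ^ 2) = Real.exp (-(1 / 2 : ℝ)) * (8 / (3 * π ^ 3) * (1 / (4 * β ^ 2))) := by ring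
    rw [this]
    exact mul_le_mul_of_nonneg_left ((mul_le_mul_of_nonneg_left h4 (by positivity)).trans h3) (Real.exp_pos _).le
  rw [hexp] at h2
  calc Real.exp (2 * β) * (Real.exp (-(1 / 2 : ℝ)) * (8 / (3 * π ^ 3)) / (4 * β ^ 2))
      ≤ Real.exp (2 * β) * (Real.exp (-(1 / 2 : ℝ)) * ballVol (1 / Real.sqrt β)) := mul_le_mul_of_nonneg_left h5 (Real.exp_pos _).le
    _ = Real.exp (2 * β) * Real.exp (-(1 / 2 : ℝ)) * ballVol (1 / Real.sqrt β) := by ring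
    _ ≤ linkC β := h2.trans h1

/-- Hence `c_β^{|E|} ≥ (e^{2β} w₀/(4β²))^{|E|}` (`β ≥ 1`). [folklore] -/
theorem latCE_ge_poly {β : ℝ} (hβ : 1 ≤ β) :
    (Real.exp (2 * β) * (Real.exp (-(1 / 2 : ℝ)) * (8 / (3 * π ^ 3)) / (4 * β ^ 2))) ^ Fintype.card (Edge 3 L) ≤ latCE L β :=
  pow_le_pow_left₀ (by positivity) (linkC_ge_poly hβ) _

omit [NeZero L] in
/-- `λ_b(L³β) ≥ 2/(L³β)` once `L³β ≥ 2` (`x ≤ x^{1/3}` for `x ≤ 1`). [folklore] -/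
theorem two_div_le_bareLambda_cube {β : ℝ} (h : 2 ≤ (L : ℝ) ^ 3 * β) : 2 / ((L : ℝ) ^ 3 * β) ≤ bareLambda ((L : ℝ) ^ 3 * β) := by
  have hpos : 0 < (L : ℝ) ^ 3 * β := lt_of_lt_of_le (by norm_num) h
  unfold bareLambda
  exact Real.self_le_rpow_of_le_one (by positivity) ((div_le_one hpos).mpr h) (by norm_num)

/-- Exponentials beat powers: `∃ β0, ∀ β ≥ β0, β^N e^{−cβ} ≤ K` (`c, K > 0`). [folklore] -/
theorem exists_pow_mul_exp_neg_le {c K : ℝ} (hc : 0 < c) (hK : 0 < K) (N : ℕ) :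
    ∃ β0 : ℝ, ∀ β : ℝ, β0 ≤ β → β ^ N * Real.exp (-(c * β)) ≤ K := by
  have ht := (Real.tendsto_pow_mul_exp_neg_atTop_nhds_zero N).comp (tendsto_id.const_mul_atTop hc)
  have hev : ∀ᶠ β : ℝ in atTop, (fun x : ℝ => x ^ N * Real.exp (-x)) (c * id β) ≤ K * c ^ N :=
    ht.eventually (ge_mem_nhds (by positivity))
  obtain ⟨β0, hβ0⟩ := Filter.eventually_atTop.mp hev
  refine ⟨β0, fun β hβ => ?_⟩
  have h := hβ0 β hβ
  simp only [id, mul_pow] at h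
  have hcN : 0 < c ^ N := pow_pos hc N
  have : c ^ N * (β ^ N * Real.exp (-(c * β))) ≤ c ^ N * K := by nlinarith [h]
  exact le_of_mul_le_mul_left this hcN

/-- ★ **The cross terms are negligible**: for `m > 0` and `ε > 0`, eventually in `β`,
`28 · crossBound L β m ≤ ε · λ_b(L³β) · (uniformFloorConst L · c_β^{|E|})`. [folklore] -/
theorem crossBound_eventually_small {m : ℝ} (hm : 0 < m) {ε : ℝ} (hε : 0 < ε) :
    ∃ β0 : ℝ, ∀ β : ℝ, β0 ≤ β → 28 * crossBound L β m ≤ ε * bareLambda ((L : ℝ) ^ 3 * β) * (uniformFloorConst L * latCE L β) := by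
  have hL : (0 : ℝ) < L := by exact_mod_cast Nat.pos_of_ne_zero (NeZero.ne L)
  have hL1 : (1 : ℝ) ≤ (L : ℝ) ^ 3 := one_le_pow₀ (by exact_mod_cast NeZero.one_le)
  have hE0 : (0 : ℝ) < Fintype.card (Edge 3 L) := by exact_mod_cast Fintype.card_pos
  have hcL := uniformFloorConst_pos (L := L)
  set w : ℝ := Real.exp (-(1 / 2 : ℝ)) * (8 / (3 * π ^ 3)) / 4 with hw
  have hw0 : 0 < w := by rw [hw]; positivity
  set K : ℝ := ε * (2 / (L : ℝ) ^ 3) * uniformFloorConst L * w ^ Fintype.card (Edge 3 L) / 28 with hK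
  have hK0 : 0 < K := by rw [hK]; positivity
  set c : ℝ := m ^ 2 / (2 * Fintype.card (Edge 3 L)) with hc
  have hc0 : 0 < c := by rw [hc]; positivity
  obtain ⟨β0, hβ0⟩ := exists_pow_mul_exp_neg_le hc0 hK0 (2 * Fintype.card (Edge 3 L) + 1)
  refine ⟨max 2 β0, fun β hβ => ?_⟩
  have hβ2 : 2 ≤ β := (le_max_left _ _).trans hβ
  have hβ1 : 1 ≤ β := by linarith
  have hβp : 0 < β := by linarith
  have hB2 : 2 ≤ (L : ℝ) ^ 3 * β := by nlinarith
  have hpow := hβ0 β ((le_max_right _ _).trans hβ)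
  -- lower bound of the right-hand side
  have hlat := latCE_ge_poly (L := L) hβ1
  have hlam := two_div_le_bareLambda_cube (L := L) hB2
  have e1 : (Real.exp (2 * β) * (Real.exp (-(1 / 2 : ℝ)) * (8 / (3 * π ^ 3)) / (4 * β ^ 2))) ^ Fintype.card (Edge 3 L) =
      Real.exp (2 * β) ^ Fintype.card (Edge 3 L) * w ^ Fintype.card (Edge 3 L) / (β ^ 2) ^ Fintype.card (Edge 3 L) := by
    rw [hw, ← mul_pow, ← div_pow]; congr 1; field_simp
  rw [e1] at hlat
  have hR : ε * (2 / ((L : ℝ) ^ 3 * β)) * (uniformFloorConst L * (Real.exp (2 * β) ^ Fintype.card (Edge 3 L) * w ^ Fintype.card (Edge 3 L) /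
      (β ^ 2) ^ Fintype.card (Edge 3 L))) ≤ ε * bareLambda ((L : ℝ) ^ 3 * β) * (uniformFloorConst L * latCE L β) := by
    have h1 : ε * (2 / ((L : ℝ) ^ 3 * β)) ≤ ε * bareLambda ((L : ℝ) ^ 3 * β) := mul_le_mul_of_nonneg_left hlam hε.le
    have hlam0 : 0 < bareLambda ((L : ℝ) ^ 3 * β) := bareLambda_pos' (by positivity)
    exact mul_le_mul h1 (mul_le_mul_of_nonneg_left hlat hcL.le) (mul_nonneg hcL.le (by positivity)) (mul_nonneg hε.le hlam0.le)
  -- upper bound of the left-hand side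
  have hexp : Real.exp (-(c * β)) ≤ K / β ^ (2 * Fintype.card (Edge 3 L) + 1) := by
    rw [le_div_iff₀ (by positivity), mul_comm]; exact hpow
  have hLHS : 28 * crossBound L β m = 28 * Real.exp (2 * β) ^ Fintype.card (Edge 3 L) * Real.exp (-(c * β)) := by
    have e : β / 2 * (m ^ 2 / Fintype.card (Edge 3 L)) = c * β := by rw [hc]; field_simp
    unfold crossBound
    rw [e]; ring
  rw [hLHS]
  refine le_trans (mul_le_mul_of_nonneg_left hexp (by positivity)) (le_trans (le_of_eq ?_) hR)
  rw [hK, pow_succ, ← pow_mul]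
  field_simp
  ring

/-! ## §5 The endgame of the reduction -/

/-- Pure-real endgame of the eight-copies reduction. [folklore] -/
theorem copies_endgame {qF qG nG μ0 μk Λ0 cB lam ε : ℝ} (hnG : 0 ≤ nG) (hμ0 : 0 ≤ μ0) (hΛ0 : 0 ≤ Λ0) (hlam : 0 ≤ lam) (hε : 0 ≤ ε)
    (hμk2 : μ0 / 2 ≤ μk) (hq : qF ≤ 8 * qG + 56 * (cB * nG)) (hI : qG * μ0 ≤ Real.exp (ε / 2 * lam) * μk * Λ0 * nG)
    (hsc : 28 * cB ≤ ε * lam * Λ0) :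
    qF * μ0 ≤ Real.exp (ε * lam) * μk * Λ0 * (8 * nG) := by
  have hgap := half_le_exp_sub_exp_half (t := ε * lam) (by positivity)
  have e1 : ε * lam / 2 = ε / 2 * lam := by ring
  rw [e1] at hgap
  have hμk0 : 0 ≤ μk := by linarith
  -- `7 cB μ0 ≤ (e^{ελ} − e^{ελ/2}) μk Λ0`
  have h1 : 7 * cB * μ0 ≤ ε * lam * Λ0 * μ0 / 4 := by
    have := mul_le_mul_of_nonneg_right hsc hμ0
    linarith
  have h2 : ε * lam * Λ0 * μ0 / 4 ≤ (Real.exp (ε * lam) - Real.exp (ε / 2 * lam)) * μk * Λ0 := by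
    have h0 : 0 ≤ ε / 2 * lam := by positivity
    have hD : 0 ≤ Real.exp (ε * lam) - Real.exp (ε / 2 * lam) := le_trans h0 hgap
    have := mul_le_mul hgap hμk2 (by positivity) hD
    have h' := mul_le_mul_of_nonneg_right this hΛ0
    have e : ε * lam * Λ0 * μ0 / 4 = ε / 2 * lam * (μ0 / 2) * Λ0 := by ring
    rw [e]; exact h'
  have h3 : qF * μ0 ≤ 8 * (qG * μ0) + 56 * (cB * nG) * μ0 := by nlinarith
  have h4 : 56 * (cB * nG) * μ0 ≤ 8 * ((Real.exp (ε * lam) - Real.exp (ε / 2 * lam)) * μk * Λ0) * nG := by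
    have := mul_le_mul_of_nonneg_right (h1.trans h2) hnG
    nlinarith
  have h5 : 8 * (qG * μ0) ≤ 8 * (Real.exp (ε / 2 * lam) * μk * Λ0 * nG) := by linarith
  nlinarith

/-! ## §6 I(L) from I₁(L) -/

/-- ★★ **INNER NO-INTRUDER from its one-orbit form**: `I₁(L) ⇒ I(L)` for positive scales that are eventually `≤ 1/(2L)`.  With
`coarseNoIntruderAt_of_valley_inner`: COARSE-UPPER(L) ⇐ V(L) + I₁(L). [cite: Luscher1983, §3] -/
theorem innerNoIntruderAt_of_oneOrbit {δ : ℝ → ℝ} (hδ : ∀ β, 0 < δ β) (hδL : ∃ β1 : ℝ, ∀ β : ℝ, β1 ≤ β → δ β ≤ 1 / (2 * L))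
    (hI1 : InnerNoIntruderOneOrbitAt L δ) : InnerNoIntruderAt L δ := by
  intro k ε hε
  have hL : (0 : ℝ) < L := by exact_mod_cast Nat.pos_of_ne_zero (NeZero.ne L)
  have hL1 : (1 : ℝ) ≤ (L : ℝ) ^ 3 := one_le_pow₀ (by exact_mod_cast NeZero.one_le)
  obtain ⟨C1, B0, hONE⟩ := oneSiteLevels_proof k
  obtain ⟨βI, hI1'⟩ := hI1 k (ε / 2) (half_pos hε)
  obtain ⟨β1, hδ1⟩ := hδL
  obtain ⟨βs, hs⟩ := crossBound_eventually_small (L := L) (m := 1 / (2 * L)) (by positivity) hε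
  have hτ0 : 0 < 1 / (2 * (|levelGap k| + |C1| + 2)) := by positivity
  refine ⟨max (max (max 1 B0) (max βI β1)) (max βs (2 / (1 / (2 * (|levelGap k| + |C1| + 2))) ^ 3)), fun β hβ => ?_⟩
  have hβ1 : 1 ≤ β := (((le_max_left _ _).trans (le_max_left _ _)).trans (le_max_left _ _)).trans hβ
  have hβ0 : 0 < β := by linarith
  have hβB0 : B0 ≤ β := (((le_max_right _ _).trans (le_max_left _ _)).trans (le_max_left _ _)).trans hβ
  have hβI : βI ≤ β := (((le_max_left _ _).trans (le_max_right _ _)).trans (le_max_left _ _)).trans hβ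
  have hβd : β1 ≤ β := (((le_max_right _ _).trans (le_max_right _ _)).trans (le_max_left _ _)).trans hβ
  have hβs : βs ≤ β := ((le_max_left _ _).trans (le_max_right _ _)).trans hβ
  have hβτ : 2 / (1 / (2 * (|levelGap k| + |C1| + 2))) ^ 3 ≤ β := ((le_max_right _ _).trans (le_max_right _ _)).trans hβ
  intro F hF hsupp hGram
  -- geometry of the scales
  have hδ0 := hδ β
  have hδ2 : δ β ≤ 1 / (2 * L) := hδ1 β hβd
  have hLδ : (L : ℝ) * δ β < 2 := by
    have := mul_le_mul_of_nonneg_left hδ2 hL.le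
    have e : (L : ℝ) * (1 / (2 * L)) = 1 / 2 := by field_simp
    linarith
  have hLm : (L : ℝ) * (δ β + 1 / (2 * L)) < 2 := by
    have := mul_le_mul_of_nonneg_left hδ2 hL.le
    have e : (L : ℝ) * (1 / (2 * L)) = 1 / 2 := by field_simp
    nlinarith
  -- one-site data
  have hB'β : β ≤ (L : ℝ) ^ 3 * β := by nlinarith
  have hB'0 : 0 < (L : ℝ) ^ 3 * β := lt_of_lt_of_le hβ0 hB'β
  obtain ⟨hμ0, -, hμk⟩ := hONE ((L : ℝ) ^ 3 * β) (hβB0.trans hB'β)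
  have hlam0 : 0 < bareLambda ((L : ℝ) ^ 3 * β) := bareLambda_pos' hB'0
  have hlamτ := bareLambda_cube_le (L := L) hτ0 hβτ
  obtain ⟨-, -, hy⟩ := smallness_of_le hlam0.le hlamτ
  have hμk' : Real.exp (-(levelGap k * bareLambda ((L : ℝ) ^ 3 * β) + |C1| * bareLambda ((L : ℝ) ^ 3 * β) ^ 2)) *
      levelValue su2Rep 1 ((L : ℝ) ^ 3 * β) 0 ≤ levelValue su2Rep 1 ((L : ℝ) ^ 3 * β) k := by
    refine le_trans (mul_le_mul_of_nonneg_right (Real.exp_le_exp.2 ?_) hμ0.le) hμk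
    have := mul_le_mul_of_nonneg_right (le_abs_self C1) (sq_nonneg (bareLambda ((L : ℝ) ^ 3 * β)))
    linarith
  have hμk2 := half_le_of_exp_lower hy hμ0.le hμk'
  have hΛ0 : 0 < levelValue su2Rep L β 0 := levelValue_su2Rep_pos hβ0 0
  have hsc : 28 * crossBound L β (1 / (2 * L)) ≤ ε * bareLambda ((L : ℝ) ^ 3 * β) * levelValue su2Rep L β 0 :=
    (hs β hβs).trans (mul_le_mul_of_nonneg_left (levelValue_zero_ge_uniform hβ1) (by positivity))
  -- the one-orbit cut family
  choose C hC using fun i => (hF i).bounded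
  obtain ⟨G, hGdef⟩ : ∃ G : Fin (k + 1) → GaugeConfig 3 L SU2 → ℝ, G = fun i => orbitCut (δ β) (F i) := ⟨_, rfl⟩
  have hGm : ∀ i, Measurable (G i) := fun i => by rw [hGdef]; exact measurable_orbitCut _ (hF i).measurable
  have hGb : ∀ i, ∃ C' : ℝ, ∀ U, |G i U| ≤ C' := fun i => ⟨C i, fun U => by rw [hGdef]; exact abs_orbitCut_le _ (hC i) U⟩
  have hGg : ∀ i (g : Site 3 L → SU2) (U : GaugeConfig 3 L SU2), G i (gaugeTransform g U) = G i U := fun i g U => by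
    rw [hGdef]; exact orbitCut_gaugeTransform _ (hF i).gaugeInv g U
  have hGs : ∀ i U, G i U ≠ 0 → orbitDist U < δ β := fun i U h => by
    rw [hGdef] at h; exact orbitDist_lt_of_orbitCut_ne_zero h
  -- combinations: `Σ aᵢFᵢ = twistSum (Σ aᵢGᵢ)`
  have hcomb : ∀ a : Fin (k + 1) → ℝ, (fun U => ∑ i, a i * F i U) = twistSum (fun U => ∑ i, a i * G i U) := fun a => by
    rw [twistSum_sum_mul]
    funext U
    refine Finset.sum_congr rfl fun i _ => ?_
    rw [hGdef, twistSum_orbitCut hLδ (hF i) (hsupp i)]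
  have hφm : ∀ a : Fin (k + 1) → ℝ, Measurable fun U => ∑ i, a i * G i U := fun a => by
    rw [hGdef]; exact measurable_sum_mul_orbitCut _ a fun i => (hF i).measurable
  have hφb : ∀ (a : Fin (k + 1) → ℝ) U, |∑ i, a i * G i U| ≤ ∑ i, |a i| * C i := fun a U => by
    rw [hGdef]; exact abs_sum_mul_orbitCut_le _ a hC U
  have hφs : ∀ (a : Fin (k + 1) → ℝ) U, ∑ i, a i * G i U ≠ 0 → orbitDist U < δ β := fun a U h => by
    rw [hGdef] at h; exact orbitDist_lt_of_sum_mul_orbitCut_ne_zero a F h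
  have hl2 : ∀ a : Fin (k + 1) → ℝ, l2 (fun U => ∑ i, a i * F i U) (fun U => ∑ i, a i * F i U) =
      8 * l2 (fun U => ∑ i, a i * G i U) (fun U => ∑ i, a i * G i U) := fun a => by
    rw [hcomb a]; exact l2_twistSum (hφm a) (hφb a) hLδ (hφs a)
  have hq : ∀ a : Fin (k + 1) → ℝ, qform su2Rep β (fun U => ∑ i, a i * F i U) (fun U => ∑ i, a i * F i U) ≤
      8 * qform su2Rep β (fun U => ∑ i, a i * G i U) (fun U => ∑ i, a i * G i U) +
        56 * (crossBound L β (1 / (2 * L)) * l2 (fun U => ∑ i, a i * G i U) (fun U => ∑ i, a i * G i U)) := fun a => by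
    rw [hcomb a]
    have h := abs_qform_twistSum_sub_le hβ0.le (hφm a) (hφb a) (by positivity : (0 : ℝ) ≤ 1 / (2 * L)) hLm (hφs a)
    rw [abs_le] at h
    linarith [h.2]
  -- Gram nondegeneracy transfers
  have hGramG : ∀ a : Fin (k + 1) → ℝ, a ≠ 0 → 0 < l2 (fun U => ∑ i, a i * G i U) (fun U => ∑ i, a i * G i U) := fun a ha => by
    have h := hGram a ha
    rw [hl2 a] at h
    linarith
  -- apply I₁ and conclude
  obtain ⟨a, ha, hIa⟩ := hI1' β hβI G hGm hGb hGg hGs hGramG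
  refine ⟨a, ha, ?_⟩
  rw [hl2 a]
  exact copies_endgame (l2_self_nonneg_lat _) hμ0.le hΛ0.le hlam0.le hε.le hμk2 (hq a) hIa hsc

end Summit.QuantumFields.YangMills.Theorems.FemtoTransferGap

end
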